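import Summits.HubbardSuperconductivity.HubbardSuperconductivity.Theorems.WidthHaldaneTubeGauge
import Summits.HubbardSuperconductivity.HubbardSuperconductivity.Theorems.WidthHaldaneTubeKinematics
import Literature.MathematicalPhysics.QuantumLattice.FermionQuasiFree
import Summits.HubbardSuperconductivity.HubbardSuperconductivity.Theorems.WidthHaldaneFreeFloor
import Literature.MathematicalPhysics.QuantumLattice.FreeFermionSpinTwistedTraceFormula

/-!
# Plane waves of the labelled tube `ℤ/L × ℤ/M` and the free (`U = 0`) floor of its sector energies

Companion of `WidthHaldaneFreeFloor.lean` (the general free-fermion sector floor via `Γ`) and of the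
free-electron vocabulary of `WidthHaldaneDefs.lean` (`tubeChar`, `tubeBand`). For
the pure Hubbard tube of the cruxes 16311/16312/18509/18510 on an arbitrary linearly ordered carrier
`e : Λ ≃ ℤ/L × ℤ/M` this file proves, sorry-free:

* character algebra and **orthogonality** of the plane waves `χ_k` of `ℤ/L × ℤ/M` (`sum_tubeChar`,
  `sum_conj_tubeChar_mul_tubeChar`) and the **stencil** `Σ_{±e₁,±e₂} χ_k(p + ·) = -ε_{L,M}(k) χ_k(p)`;
* `tubeGraph_adj_iff`, `sum_adj_tubeGraph` — adjacency of the `fromRel` tube graph and the neighbour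
  sum for `L, M ≥ 3` (four distinct neighbours);
* `tubeH0_zero_eq_dGamma` — the free tube is `dΓ(hubbardOneBody (tubeGraph e) 1 0)`;
* `conjTranspose_planeWaves_mul_self`, `hubbardOneBody_tubeGraph_mul_planeWaves` — the plane-wave mode
  matrix `V_{(x,σ),(z,τ)} = δ_{στ} χ_{e z}(e x)/√(LM)` (spelled out; it is the `tubePlaneWaves` proposed for
  `WidthHaldaneDefs`) is unitary, spin-diagonal and diagonalises the hopping matrix with the
  spin-independent spectrum `tubeBand L M ∘ e`;
* **`tubeEnergy_free_eq`** — `tubeEnergy L M Λ e 0 0 (2 #F) = 2 Σ_{k∈F} tubeBand L M k` for every Fermi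
  set `F` of the band (`L, M ≥ 3`): the exact `U = 0` value of the untwisted sector energies entering
  `tubePairCompressibility` (consumer: `PerWidthThermodynamics/Negative/ZeroCouplingCompressibility`).

Sources: S. Friedli, Y. Velenik, *Statistical Mechanics of Lattice Systems* (2017) §10.4 (characters
of the discrete torus); D. J. Scalapino, Phys. Rep. 250 (1995) 329 §2 (tight-binding band);
J. Bardeen, L. N. Cooper, J. R. Schrieffer, Phys. Rev. 108 (1957) 1175 §II. Folklore; no definitions,
no named facts. REUSED: `ZMod.stdAddChar`, `AddChar.sum_mulShift`, `ZMod.isPrimitive_stdAddChar`,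
`ZMod.toCircle_apply` (Mathlib); `hamiltonianWith_zero_eq_dGamma`, `hubbardOneBody_apply`,
`sum_orb_eq_sum_sum`, `two_ne_zero_zmod`, `tubeEnergy_zero`, `minEnergyOn_dGamma_szSector_eq_of_eigen`.
-/

noncomputable section

namespace Summit.HubbardSuperconductivity.HubbardSuperconductivity.Theorems.WidthHaldane

set_option linter.dupNamespace false -- summit = problem name (single-conjunct summit), D-0017

open scoped BigOperators Classical Matrix ComplexConjugate
open Matrix Finset Literature.MathematicalPhysics.QuantumLattice

/-! ### Characters of `ℤ/L × ℤ/M` -/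

section Char

variable {L M : ℕ} [NeZero L] [NeZero M]

/-- `χ_k(p + q) = χ_k(p) χ_k(q)`. [folklore] -/
theorem tubeChar_add_right (k p q : ZMod L × ZMod M) :
    tubeChar L M k (p + q) = tubeChar L M k p * tubeChar L M k q := by
  simp only [tubeChar, Prod.fst_add, Prod.snd_add, mul_add, AddChar.map_add_eq_mul]
  ring

/-- `χ_k(-p) = conj χ_k(p)`. [folklore] -/
theorem tubeChar_neg_right (k p : ZMod L × ZMod M) :
    tubeChar L M k (-p) = conj (tubeChar L M k p) := by
  simp only [tubeChar, Prod.fst_neg, Prod.snd_neg, mul_neg, AddChar.map_neg_eq_conj, map_mul]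

/-- `χ_k(p - q) = χ_k(p) conj χ_k(q)`. [folklore] -/
theorem tubeChar_sub_right (k p q : ZMod L × ZMod M) :
    tubeChar L M k (p - q) = tubeChar L M k p * conj (tubeChar L M k q) := by
  rw [sub_eq_add_neg, tubeChar_add_right, tubeChar_neg_right]

/-- `χ_k(p) = χ_p(k)`. [folklore] -/
theorem tubeChar_comm (k p : ZMod L × ZMod M) : tubeChar L M k p = tubeChar L M p k := by
  simp only [tubeChar, mul_comm]

/-- `conj χ_k(p) · χ_{k'}(p) = χ_{k'-k}(p)`. [folklore] -/
theorem conj_tubeChar_mul_tubeChar (k k' p : ZMod L × ZMod M) :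
    conj (tubeChar L M k p) * tubeChar L M k' p = tubeChar L M (k' - k) p := by
  rw [tubeChar_comm k, tubeChar_comm k', mul_comm, ← tubeChar_sub_right, tubeChar_comm]

/-- **Orthogonality of the characters of `ℤ/L × ℤ/M`** (sum over the group): `Σ_p χ_k(p) = LM`
if `k = 0` and `0` otherwise (product of Mathlib's `AddChar.sum_mulShift` for the primitive characters
`ZMod.stdAddChar` of the two factors). Friedli–Velenik (2017) §10.4. [cite: FriedliVelenik2017, §10.4] -/
theorem sum_tubeChar (k : ZMod L × ZMod M) :
    ∑ p : ZMod L × ZMod M, tubeChar L M k p = if k = 0 then ((L * M : ℕ) : ℂ) else 0 := by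
  have h1 : ∑ a : ZMod L, (ZMod.stdAddChar (k.1 * a) : ℂ) = if k.1 = 0 then (L : ℂ) else 0 := by
    simp_rw [mul_comm k.1]
    rw [AddChar.sum_mulShift k.1 (ZMod.isPrimitive_stdAddChar L), ZMod.card, Nat.cast_ite, Nat.cast_zero]
  have h2 : ∑ b : ZMod M, (ZMod.stdAddChar (k.2 * b) : ℂ) = if k.2 = 0 then (M : ℂ) else 0 := by
    simp_rw [mul_comm k.2]
    rw [AddChar.sum_mulShift k.2 (ZMod.isPrimitive_stdAddChar M), ZMod.card, Nat.cast_ite, Nat.cast_zero]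
  calc ∑ p : ZMod L × ZMod M, tubeChar L M k p
      = (∑ a : ZMod L, (ZMod.stdAddChar (k.1 * a) : ℂ)) * ∑ b : ZMod M, (ZMod.stdAddChar (k.2 * b) : ℂ) := by
        rw [Fintype.sum_prod_type, Finset.sum_mul_sum]
        rfl
    _ = if k = 0 then ((L * M : ℕ) : ℂ) else 0 := by
        rw [h1, h2]
        have hk : k = 0 ↔ k.1 = 0 ∧ k.2 = 0 := Prod.ext_iff
        by_cases ha : k.1 = 0 <;> by_cases hb : k.2 = 0 <;> simp [hk, ha, hb]

/-- **Orthogonality of the plane waves**: `Σ_p conj χ_k(p) χ_{k'}(p) = LM·[k = k']`. [folklore] -/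
theorem sum_conj_tubeChar_mul_tubeChar (k k' : ZMod L × ZMod M) :
    ∑ p : ZMod L × ZMod M, conj (tubeChar L M k p) * tubeChar L M k' p =
      if k = k' then ((L * M : ℕ) : ℂ) else 0 := by
  simp_rw [conj_tubeChar_mul_tubeChar, sum_tubeChar, sub_eq_zero, eq_comm]

/-- `e(a) = exp(2πi a.val/N)` (Mathlib `ZMod.toCircle_apply`). [folklore] -/
theorem stdAddChar_eq_exp {N : ℕ} [NeZero N] (a : ZMod N) :
    (ZMod.stdAddChar a : ℂ) = Complex.exp (2 * Real.pi * Complex.I * (a.val : ℂ) / N) := by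
  rw [ZMod.stdAddChar_apply, ZMod.toCircle_apply]

/-- `e(a) + e(-a) = 2cos(2π a.val/N)`. [folklore] -/
theorem stdAddChar_add_stdAddChar_neg {N : ℕ} [NeZero N] (a : ZMod N) :
    (ZMod.stdAddChar a : ℂ) + ZMod.stdAddChar (-a) = ((2 * Real.cos (2 * Real.pi * (a.val : ℝ) / N) : ℝ) : ℂ) := by
  rw [AddChar.map_neg_eq_conj, Complex.add_conj, stdAddChar_eq_exp]
  congr 1
  have : (2 * Real.pi * Complex.I * (a.val : ℂ) / N) = ((2 * Real.pi * (a.val : ℝ) / N : ℝ) : ℂ) * Complex.I := by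
    push_cast
    ring
  rw [this, Complex.exp_ofReal_mul_I_re]

/-- **The nearest-neighbour stencil on a plane wave**:
`χ_k(p+e₁) + χ_k(p-e₁) + χ_k(p+e₂) + χ_k(p-e₂) = -ε_{L,M}(k) χ_k(p)`, `ε_{L,M} = tubeBand`.
Scalapino (1995) §2 (the tight-binding band). [folklore] -/
theorem tubeChar_stencil (k p : ZMod L × ZMod M) :
    tubeChar L M k (p + (1, 0)) + tubeChar L M k (p - (1, 0)) + tubeChar L M k (p + (0, 1)) +
        tubeChar L M k (p - (0, 1)) =
      tubeChar L M k p * ((-(tubeBand L M k) : ℝ) : ℂ) := by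
  have e1 : tubeChar L M k (1, 0) = ZMod.stdAddChar k.1 := by simp [tubeChar]
  have e2 : tubeChar L M k (0, 1) = ZMod.stdAddChar k.2 := by simp [tubeChar]
  have e1' : tubeChar L M k (-(1, 0)) = ZMod.stdAddChar (-k.1) := by
    rw [tubeChar_neg_right, e1, AddChar.map_neg_eq_conj]
  have e2' : tubeChar L M k (-(0, 1)) = ZMod.stdAddChar (-k.2) := by
    rw [tubeChar_neg_right, e2, AddChar.map_neg_eq_conj]
  rw [sub_eq_add_neg, sub_eq_add_neg, tubeChar_add_right, tubeChar_add_right, tubeChar_add_right,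
    tubeChar_add_right, e1, e2, e1', e2']
  have h1 := stdAddChar_add_stdAddChar_neg k.1
  have h2 := stdAddChar_add_stdAddChar_neg k.2
  rw [tubeBand]
  push_cast at h1 h2 ⊢
  linear_combination tubeChar L M k p * h1 + tubeChar L M k p * h2

end Char



/-! ### The neighbour stencil of the labelled tube -/

section Stencil

variable {L M : ℕ} [NeZero L] [NeZero M] {Λ : Type} [LinearOrder Λ] [Fintype Λ]
  (e : Λ ≃ ZMod L × ZMod M)

omit [NeZero L] [NeZero M] [LinearOrder Λ] [Fintype Λ] in
/-- Adjacency in the labelled tube: `x ∼ y` iff `e y - e x ∈ {±e₁, ±e₂}` (and `x ≠ y`). [folklore] -/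
theorem tubeGraph_adj_iff (x y : Λ) :
    (tubeGraph e).Adj x y ↔ x ≠ y ∧ (e y = e x + (1, 0) ∨ e y = e x + (0, 1) ∨
      e y = e x - (1, 0) ∨ e y = e x - (0, 1)) := by
  have k1 : ∀ u v : Λ, v = e.symm ((e u).1 + 1, (e u).2) ↔ e v = e u + (1, 0) := fun u v => by
    rw [Equiv.eq_symm_apply]
    constructor <;> intro h <;> (rw [h]; ext <;> simp)
  have k2 : ∀ u v : Λ, v = e.symm ((e u).1, (e u).2 + 1) ↔ e v = e u + (0, 1) := fun u v => by
    rw [Equiv.eq_symm_apply]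
    constructor <;> intro h <;> (rw [h]; ext <;> simp)
  have k3 : e x = e y + (1, 0) ↔ e y = e x - (1, 0) := by
    constructor <;> intro h <;> (rw [h]; simp)
  have k4 : e x = e y + (0, 1) ↔ e y = e x - (0, 1) := by
    constructor <;> intro h <;> (rw [h]; simp)
  rw [SimpleGraph.fromRel_adj, k1, k2, k1, k2, k3, k4]
  tauto

/-- **The neighbour sum of the tube.** For `L, M ≥ 3` the four neighbours `e⁻¹(e x ± e₁)`, `e⁻¹(e x ± e₂)`
of `x` are pairwise distinct, so `Σ_y [x ∼ y] f(y)` is the sum of `f` over them. [folklore] -/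
theorem sum_adj_tubeGraph (hL : 3 ≤ L) (hM : 3 ≤ M) {β : Type*} [AddCommMonoid β] (f : Λ → β) (x : Λ) :
    ∑ y, (if (tubeGraph e).Adj x y then f y else 0) =
      f (e.symm (e x + (1, 0))) + f (e.symm (e x + (0, 1))) + f (e.symm (e x - (1, 0))) +
        f (e.symm (e x - (0, 1))) := by
  haveI : Fact (1 < L) := ⟨by omega⟩
  haveI : Fact (1 < M) := ⟨by omega⟩
  have h2L := two_ne_zero_zmod L hL
  have h2M := two_ne_zero_zmod M hM
  set p₁ : ZMod L × ZMod M := e x + (1, 0) with hp₁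
  set p₂ : ZMod L × ZMod M := e x + (0, 1) with hp₂
  set p₃ : ZMod L × ZMod M := e x - (1, 0) with hp₃
  set p₄ : ZMod L × ZMod M := e x - (0, 1) with hp₄
  -- pairwise distinct, and distinct from `e x`
  have h12 : p₁ ≠ p₂ := by
    rw [hp₁, hp₂, Ne, add_right_inj]; intro h; exact one_ne_zero (congrArg Prod.fst h)
  have h13 : p₁ ≠ p₃ := by
    rw [hp₁, hp₃, sub_eq_add_neg, Ne, add_right_inj]; intro h
    have h' : (1 : ZMod L) = -1 := congrArg Prod.fst h
    exact h2L (by linear_combination h')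
  have h14 : p₁ ≠ p₄ := by
    rw [hp₁, hp₄, sub_eq_add_neg, Ne, add_right_inj]; intro h
    have h' : (1 : ZMod L) = 0 := by simpa using congrArg Prod.fst h
    exact one_ne_zero h'
  have h23 : p₂ ≠ p₃ := by
    rw [hp₂, hp₃, sub_eq_add_neg, Ne, add_right_inj]; intro h
    have h' : (1 : ZMod M) = 0 := by simpa using congrArg Prod.snd h
    exact one_ne_zero h'
  have h24 : p₂ ≠ p₄ := by
    rw [hp₂, hp₄, sub_eq_add_neg, Ne, add_right_inj]; intro h
    have h' : (1 : ZMod M) = -1 := congrArg Prod.snd h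
    exact h2M (by linear_combination h')
  have h34 : p₃ ≠ p₄ := by
    rw [hp₃, hp₄, sub_eq_add_neg, sub_eq_add_neg, Ne, add_right_inj]; intro h
    have h' : (-1 : ZMod L) = 0 := by simpa using congrArg Prod.fst h
    exact one_ne_zero (neg_eq_zero.1 h')
  have h1x : p₁ ≠ e x := by rw [hp₁, Ne, add_eq_left]; intro h; exact one_ne_zero (congrArg Prod.fst h)
  have h2x : p₂ ≠ e x := by rw [hp₂, Ne, add_eq_left]; intro h; exact one_ne_zero (congrArg Prod.snd h)
  have h3x : p₃ ≠ e x := by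
    rw [hp₃, Ne, sub_eq_self]; intro h; exact one_ne_zero (congrArg Prod.fst h)
  have h4x : p₄ ≠ e x := by
    rw [hp₄, Ne, sub_eq_self]; intro h; exact one_ne_zero (congrArg Prod.snd h)
  -- membership in the neighbour set
  have hiff : ∀ p : ZMod L × ZMod M, (x ≠ e.symm p ∧ (p = p₁ ∨ p = p₂ ∨ p = p₃ ∨ p = p₄)) ↔
      p ∈ ({p₁, p₂, p₃, p₄} : Finset (ZMod L × ZMod M)) := by
    intro p
    simp only [mem_insert, mem_singleton]
    refine ⟨And.right, fun h => ⟨?_, h⟩⟩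
    intro hx
    have hp : p = e x := by rw [hx, Equiv.apply_symm_apply]
    rcases h with rfl | rfl | rfl | rfl
    · exact h1x hp
    · exact h2x hp
    · exact h3x hp
    · exact h4x hp
  calc ∑ y, (if (tubeGraph e).Adj x y then f y else 0)
      = ∑ p : ZMod L × ZMod M, (if p ∈ ({p₁, p₂, p₃, p₄} : Finset (ZMod L × ZMod M)) then f (e.symm p) else 0) := by
        rw [← Equiv.sum_comp e.symm]
        refine Finset.sum_congr rfl fun p _ => ?_
        have hc : (tubeGraph e).Adj x (e.symm p) ↔ p ∈ ({p₁, p₂, p₃, p₄} : Finset (ZMod L × ZMod M)) := by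
          rw [tubeGraph_adj_iff, Equiv.apply_symm_apply]
          exact hiff p
        exact if_congr hc rfl rfl
    _ = ∑ p ∈ ({p₁, p₂, p₃, p₄} : Finset (ZMod L × ZMod M)), f (e.symm p) := by
        rw [← Finset.sum_filter, Finset.filter_mem_eq_inter, Finset.univ_inter]
    _ = f (e.symm p₁) + f (e.symm p₂) + f (e.symm p₃) + f (e.symm p₄) := by
        rw [sum_insert, sum_insert, sum_insert, sum_singleton, ← add_assoc, ← add_assoc]
        · simpa using h34
        · simp only [mem_insert, mem_singleton, not_or]; exact ⟨h23, h24⟩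
        · simp only [mem_insert, mem_singleton, not_or]; exact ⟨h12, h13, h14⟩

end Stencil





/-! ### The free tube is `dΓ` of its hopping matrix; plane waves diagonalise it -/

section PlaneWaves

variable {L M : ℕ} [NeZero L] [NeZero M] {Λ : Type} [LinearOrder Λ] [Fintype Λ]
  (e : Λ ≃ ZMod L × ZMod M)

omit [NeZero L] [NeZero M] in
/-- **The free tube is quadratic**: `tubeH0 L M Λ e 0 = dΓ(h)` with `h = hubbardOneBody (tubeGraph e) 1 0`
(`-1` on adjacent equal-spin orbitals). BGM (2006) §2.1 via `hamiltonianWith_zero_eq_dGamma`. [folklore] -/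
theorem tubeH0_zero_eq_dGamma : tubeH0 L M Λ e 0 = dGamma (hubbardOneBody (tubeGraph e) 1 0) := by
  rw [tubeH0_eq, ← hamiltonianWith_zero, hamiltonianWith_zero_eq_dGamma]

/-- The plane-wave normalisation: `(1/√(LM))² · LM = 1`. [folklore] -/
theorem sqrt_inv_mul_self_mul : ((Real.sqrt ((L : ℝ) * M))⁻¹ : ℝ) * (Real.sqrt ((L : ℝ) * M))⁻¹ * ((L * M : ℕ) : ℝ) = 1 := by
  have hpos : (0 : ℝ) < (L : ℝ) * M := by
    have hL : (0 : ℝ) < L := Nat.cast_pos.2 (Nat.pos_of_ne_zero (NeZero.ne L))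
    have hM : (0 : ℝ) < M := Nat.cast_pos.2 (Nat.pos_of_ne_zero (NeZero.ne M))
    positivity
  rw [← mul_inv, ← Real.sqrt_mul hpos.le, Real.sqrt_mul_self hpos.le, Nat.cast_mul, inv_mul_cancel₀ hpos.ne']

/-- **The plane-wave mode matrix is an isometry (hence unitary)**: `Vᴴ V = 1`
(orthonormality of the normalised plane waves, spin by spin; `V` is the mode matrix
`V_{(x,σ),(z,τ)} = δ_{στ} χ_{e z}(e x)/√(LM)` = `tubePlaneWaves` of `WidthHaldaneDefs`). Friedli–Velenik (2017) §10.4. [folklore] -/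
theorem conjTranspose_planeWaves_mul_self :
    (Matrix.of fun o o' : Orb Λ => if (ofLex o).2 = (ofLex o').2 then
        (((Real.sqrt ((L : ℝ) * M))⁻¹ : ℝ) : ℂ) * tubeChar L M (e (ofLex o').1) (e (ofLex o).1) else 0)ᴴ *
      (Matrix.of fun o o' : Orb Λ => if (ofLex o).2 = (ofLex o').2 then
        (((Real.sqrt ((L : ℝ) * M))⁻¹ : ℝ) : ℂ) * tubeChar L M (e (ofLex o').1) (e (ofLex o).1) else 0) = 1 := by
  ext o₁ o₂
  rw [Matrix.mul_apply, Matrix.one_apply, sum_orb_eq_sum_sum]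
  simp only [conjTranspose_apply, Matrix.of_apply, orb, ofLex_toLex]
  by_cases hτ : (ofLex o₁).2 = (ofLex o₂).2
  · -- same spin: orthogonality of the plane waves
    have hsum : ∀ y : Λ, (∑ σ : Fin 2,
        star (if σ = (ofLex o₁).2 then (((Real.sqrt ((L : ℝ) * M))⁻¹ : ℝ) : ℂ) * tubeChar L M (e (ofLex o₁).1) (e y) else 0) *
          (if σ = (ofLex o₂).2 then (((Real.sqrt ((L : ℝ) * M))⁻¹ : ℝ) : ℂ) * tubeChar L M (e (ofLex o₂).1) (e y) else 0)) =
        (((Real.sqrt ((L : ℝ) * M))⁻¹ : ℝ) : ℂ) * (((Real.sqrt ((L : ℝ) * M))⁻¹ : ℝ) : ℂ) *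
          (conj (tubeChar L M (e (ofLex o₁).1) (e y)) * tubeChar L M (e (ofLex o₂).1) (e y)) := by
      intro y
      rw [Finset.sum_eq_single (ofLex o₁).2]
      · rw [if_pos rfl, if_pos hτ, star_mul', Complex.star_def, Complex.conj_ofReal]
        ring
      · intro σ _ hσ
        rw [if_neg hσ, star_zero, zero_mul]
      · intro h; exact absurd (mem_univ _) h
    simp_rw [hsum]
    rw [← Finset.mul_sum, show (∑ y : Λ, conj (tubeChar L M (e (ofLex o₁).1) (e y)) * tubeChar L M (e (ofLex o₂).1) (e y)) =
        ∑ p : ZMod L × ZMod M, conj (tubeChar L M (e (ofLex o₁).1) p) * tubeChar L M (e (ofLex o₂).1) p from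
      e.sum_comp (fun p => conj (tubeChar L M (e (ofLex o₁).1) p) * tubeChar L M (e (ofLex o₂).1) p),
      sum_conj_tubeChar_mul_tubeChar]
    have ho : o₁ = o₂ ↔ e (ofLex o₁).1 = e (ofLex o₂).1 := by
      rw [e.apply_eq_iff_eq]
      constructor
      · rintro rfl; rfl
      · intro h
        apply ofLex.injective
        exact Prod.ext h hτ
    by_cases h12 : o₁ = o₂
    · rw [if_pos h12, if_pos (ho.1 h12)]
      exact_mod_cast sqrt_inv_mul_self_mul (L := L) (M := M)
    · rw [if_neg h12, if_neg (fun h => h12 (ho.2 h)), mul_zero]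
  · -- different spins: every summand vanishes, and `o₁ ≠ o₂`
    rw [if_neg (fun h => hτ (by rw [h]))]
    refine Finset.sum_eq_zero fun y _ => Finset.sum_eq_zero fun σ _ => ?_
    by_cases h1 : σ = (ofLex o₁).2
    · rw [if_neg (fun h2 => hτ (h1.symm.trans h2)), mul_zero]
    · rw [if_neg h1, star_zero, zero_mul]

/-- **Plane waves diagonalise the free tube** (`L, M ≥ 3`): `h V = V diag(ε_{L,M} ∘ e ∘ site)` for the hopping
matrix `h = hubbardOneBody (tubeGraph e) 1 0` and the plane-wave mode matrix `V` — the column of `(z, τ)`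
is an eigenvector with eigenvalue `tubeBand L M (e z)`. Scalapino (1995) §2. [folklore] -/
theorem hubbardOneBody_tubeGraph_mul_planeWaves (hL : 3 ≤ L) (hM : 3 ≤ M) :
    hubbardOneBody (tubeGraph e) 1 0 *
        (Matrix.of fun o o' : Orb Λ => if (ofLex o).2 = (ofLex o').2 then
        (((Real.sqrt ((L : ℝ) * M))⁻¹ : ℝ) : ℂ) * tubeChar L M (e (ofLex o').1) (e (ofLex o).1) else 0) =
      (Matrix.of fun o o' : Orb Λ => if (ofLex o).2 = (ofLex o').2 then
        (((Real.sqrt ((L : ℝ) * M))⁻¹ : ℝ) : ℂ) * tubeChar L M (e (ofLex o').1) (e (ofLex o).1) else 0) *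
        diagonal fun o => ((tubeBand L M (e (ofLex o).1) : ℝ) : ℂ) := by
  ext o o'
  rw [mul_diagonal, Matrix.mul_apply, sum_orb_eq_sum_sum]
  simp only [hubbardOneBody_apply, Matrix.of_apply, orb, ofLex_toLex, Complex.ofReal_zero,
    Complex.ofReal_one, ite_self, sub_zero]
  -- the spin sum collapses to `σ'' = (ofLex o).2`
  have hsum : ∀ y : Λ, (∑ σ : Fin 2,
      (if (tubeGraph e).Adj (ofLex o).1 y ∧ (ofLex o).2 = σ then (-1 : ℂ) else 0) *
        (if σ = (ofLex o').2 then (((Real.sqrt ((L : ℝ) * M))⁻¹ : ℝ) : ℂ) * tubeChar L M (e (ofLex o').1) (e y) else 0)) =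
      if (ofLex o).2 = (ofLex o').2 then
        (if (tubeGraph e).Adj (ofLex o).1 y then
          -((((Real.sqrt ((L : ℝ) * M))⁻¹ : ℝ) : ℂ) * tubeChar L M (e (ofLex o').1) (e y)) else 0) else 0 := by
    intro y
    rw [Finset.sum_eq_single (ofLex o).2]
    · simp
    · intro σ _ hσ
      rw [if_neg (fun h => hσ h.2.symm), zero_mul]
    · intro h; exact absurd (mem_univ _) h
  simp_rw [hsum]
  by_cases hτ : (ofLex o).2 = (ofLex o').2
  · simp_rw [if_pos hτ]
    rw [sum_adj_tubeGraph e hL hM]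
    simp only [Equiv.apply_symm_apply]
    have hst := tubeChar_stencil (e (ofLex o').1) (e (ofLex o).1)
    push_cast at hst ⊢
    linear_combination -((Real.sqrt ((L : ℝ) * M) : ℂ))⁻¹ * hst
  · simp_rw [if_neg hτ]
    rw [Finset.sum_const_zero, zero_mul]

/-! ### The free floor of the labelled tube -/

/-- **The free floor of the rectangular tube.** For `L, M ≥ 3`, every linearly ordered carrier
`e : Λ ≃ ℤ/L × ℤ/M` and every Fermi set `F` of the free band (`ε_{L,M} ≤ μ` on `F`, `μ ≤ ε_{L,M}` off `F`),
the untwisted `U = 0` sector energy of the cruxes is the paired Fermi sea energy: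
`tubeEnergy L M Λ e 0 0 (2 #F) = 2 Σ_{k∈F} ε_{L,M}(k)` (`minEnergyOn_dGamma_szSector_eq_of_eigen` with the
plane-wave mode matrix). Bardeen–Cooper–Schrieffer (1957) §II. [folklore] -/
theorem tubeEnergy_free_eq (hL : 3 ≤ L) (hM : 3 ≤ M) (F : Finset (ZMod L × ZMod M)) (μ : ℝ)
    (hF : ∀ k ∈ F, tubeBand L M k ≤ μ) (hF' : ∀ k ∉ F, μ ≤ tubeBand L M k) :
    tubeEnergy L M Λ e 0 0 (2 * F.card) = 2 * ∑ k ∈ F, tubeBand L M k := by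
  -- transport the Fermi set to the carrier
  set F' : Finset Λ := F.map e.symm.toEmbedding with hF'def
  have hcard : F'.card = F.card := Finset.card_map _
  have hmem : ∀ x : Λ, x ∈ F' ↔ e x ∈ F := fun x => by
    rw [hF'def, Finset.mem_map_equiv]
    simp
  have hsumF : ∑ x ∈ F', tubeBand L M (e x) = ∑ k ∈ F, tubeBand L M k := by
    rw [hF'def, Finset.sum_map]
    simp
  rw [tubeEnergy_zero L M Λ e, tubeH0_zero_eq_dGamma, ← hcard, ← hsumF]
  exact minEnergyOn_dGamma_szSector_eq_of_eigen (hubbardOneBody (tubeGraph e) 1 0) _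
    (conjTranspose_planeWaves_mul_self e) (fun o o' h => by rw [Matrix.of_apply, if_neg h])
    (fun x => tubeBand L M (e x)) (hubbardOneBody_tubeGraph_mul_planeWaves e hL hM) F' μ
    (fun x hx => hF (e x) ((hmem x).1 hx)) (fun x hx => hF' (e x) (fun h => hx ((hmem x).2 h)))

end PlaneWaves

end Summit.HubbardSuperconductivity.HubbardSuperconductivity.Theorems.WidthHaldane

end
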